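import Summits.QuantumFields.YangMills.Theorems.UnitScaleTiltSmoothLiftInterpPlaq
import Summits.QuantumFields.YangMills.Theorems.UnitScaleTiltMinimiserStabilityRegPrAvgActionDefect
import Summits.QuantumFields.YangMills.Theorems.UnitScaleTiltMinimiserStabilityRegPrAvgCurvGrad
import Literature.Analysis.Complex.RungeBoxes
import HarnessLib

/-!
# Route `UnitScaleTilt`, crux K1 child «MinimiserStabilityRegPr» (stmt-QuantumFields-19200), stub `stub_smoothLift` (G-K1a-2′) — helper P4a:
# THE ACTION FROM THE BLOCK STRUCTURE ALONE, AND THE COARSE FIELD'S LOG-CURVATURE IS COVARIANTLY CONSTANT UP TO `(3/2)b`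

Fleet seat `ym-ust-19200-p2` (gen 0).  `SmoothLiftAt L C₁ C₂ c`: every `SU(2)` field `U` on the finest lattice of run `K` of a member of the
`d = 3` family with block size `L`, with plaquettes `< a` and curvature gradients `≤ b` (`a, b ≤ c`), has an EXACT lift `U″` through one (0.4)
averaging with the printed exp-mean-log operation (`D_{K,K+1}U″ = U`), plaquettes `< C₁(a+b)`, gradients `≤ C₁(b+a²)`, and
`L·A(U″) ≤ A(U) + C₂(b² + ab + a³)·L^{3(m+K)}`.

This file supplies the two generic inputs of the assembly (next file): §1 **`wilsonAction4_le_of_structure`** — any fine field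
whose plaquettes at the sites of `B(y)` are within `K` of `exp(F(y)/L²)` carries `L^{d−4}` of the action of `V` up to
`16a³ + 2aL²K + (4a² + L²K)²` per coarse plaquette (the block computation of `UnitScaleTiltSmoothLiftInterpAction`, freed from the
interpolation); §2 **`norm_plaqElt_sub_one_le`** (all ordered plaquettes are `a`-close to `1`) and **`norm_conj_curv_sub_curv_le`**:
Bałaban's regularity (1.1) `|∇ log V(∂p)| ≤ b` (backward covariant derivatives, `AvgCurvGrad.covDerivT_plaqFT_shift_eq`) gives the
covariant-constancy defect `‖V(y,κ)F(y+e_κ)V(y,κ)* − F(y)‖ ≤ (3/2)b` of the log-curvature used by the interpolation files.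
[cite: King1986, (A.5) p.676; Balaban1985RegularSpaces, (1.1) p.76]
-/

noncomputable section

open scoped BigOperators Matrix.Norms.L2Operator

namespace Summit.QuantumFields.YangMills.Theorems.SmoothLift

open Literature.MathematicalPhysics.QuantumFieldTheory.Balaban1983to89
open NormedSpace MatrixLog T4Continuum BlockAveraging AveragingRT ExpMeanLog BlockAveragingSection BlockAveragingSectionPlaq
open B10Eq27TorusAxialLog (toUField unitsField)
open B10Eq68TorusRegularity (plaqFT covDerivT)
open Summit.QuantumFields.YangMills.Theorems.SmoothLiftInterp
open Summit.QuantumFields.YangMills.Theorems.AvgCurvGrad (covDerivT_plaqFT_shift_eq)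
open Summit.QuantumFields.YangMills.Theorems.AvgActionDefect (sum_coarse_block one_sub_reTr_eq_half_dist1_sq_su2)

/-! ## §1 The action from the block structure alone -/

section Action

variable {P : Params} {j : ℕ}

/-- One small group element against an exponential: `‖W − e^Y‖ ≤ K`, `‖Y‖ ≤ 1` ⇒ `1 − Re tr W ≤ ½(‖Y‖ + ‖Y‖² + K)²` on `SU(2)`
(`1 − Re tr W = ½|W − 1|²`, `‖e^Y − 1‖ ≤ ‖Y‖ + ‖Y‖²`). [folklore] -/
theorem one_sub_reTr_le_of_near_exp {W : Matrix.specialUnitaryGroup (Fin 2) ℂ} {Y : Matrix (Fin 2) (Fin 2) ℂ} {K : ℝ}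
    (hW : ‖(W : Matrix (Fin 2) (Fin 2) ℂ) - exp Y‖ ≤ K) (hY : ‖Y‖ ≤ 1) :
    1 - reTr W ≤ 1 / 2 * (‖Y‖ + ‖Y‖ ^ 2 + K) ^ 2 := by
  rw [one_sub_reTr_eq_half_dist1_sq_su2]
  have hd : dist1 W = ‖(W : Matrix (Fin 2) (Fin 2) ℂ) - 1‖ := rfl
  have hexp : ‖exp Y - 1‖ ≤ ‖Y‖ + ‖Y‖ ^ 2 := by
    have h1 : exp Y - 1 = (exp Y - 1 - Y) + Y := by abel
    rw [h1]
    have h2 := Literature.Analysis.Complex.norm_exp_sub_one_sub_le hY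
    exact (norm_add_le _ _).trans (by linarith)
  have hdist : dist1 W ≤ ‖Y‖ + ‖Y‖ ^ 2 + K := by
    rw [hd, show (W : Matrix (Fin 2) (Fin 2) ℂ) - 1 = ((W : Matrix (Fin 2) (Fin 2) ℂ) - exp Y) + (exp Y - 1) by abel]
    exact (norm_add_le _ _).trans (by linarith)
  have h0 := GaugeGroup.dist1_nonneg W
  have := mul_self_le_mul_self h0 hdist
  nlinarith

/-- One small group element from below: `‖Q − 1‖ ≤ 1/3`, `‖log Q‖ ≤ 1` ⇒ `½(‖log Q‖ − ‖log Q‖²)² ≤ 1 − Re tr Q` on `SU(2)`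
(`e^{log Q} = Q`, `‖e^Y − 1‖ ≥ ‖Y‖ − ‖Y‖²`). [folklore] -/
theorem half_sq_le_one_sub_reTr {Q : Matrix.specialUnitaryGroup (Fin 2) ℂ} (hQ : ‖(Q : Matrix (Fin 2) (Fin 2) ℂ) - 1‖ ≤ 1 / 3)
    (hc1 : ‖mlog (Q : Matrix (Fin 2) (Fin 2) ℂ)‖ ≤ 1) :
    1 / 2 * (‖mlog (Q : Matrix (Fin 2) (Fin 2) ℂ)‖ - ‖mlog (Q : Matrix (Fin 2) (Fin 2) ℂ)‖ ^ 2) ^ 2 ≤ 1 - reTr Q := by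
  rw [one_sub_reTr_eq_half_dist1_sq_su2]
  set c := mlog (Q : Matrix (Fin 2) (Fin 2) ℂ) with hc
  have hd : dist1 Q = ‖(Q : Matrix (Fin 2) (Fin 2) ℂ) - 1‖ := rfl
  have hce : exp c = (Q : Matrix (Fin 2) (Fin 2) ℂ) := exp_mlog (hQ.trans_lt (by norm_num))
  have hlow : ‖c‖ - ‖c‖ ^ 2 ≤ dist1 Q := by
    rw [hd, ← hce]
    have h2 := Literature.Analysis.Complex.norm_exp_sub_one_sub_le hc1
    have h3 : ‖c‖ ≤ ‖exp c - 1‖ + ‖exp c - 1 - c‖ := by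
      calc ‖c‖ = ‖(exp c - 1) - (exp c - 1 - c)‖ := by congr 1; abel
        _ ≤ _ := norm_sub_le _ _
    linarith
  have h0 : 0 ≤ ‖c‖ - ‖c‖ ^ 2 := by nlinarith [norm_nonneg c]
  have := mul_self_le_mul_self h0 hlow
  nlinarith

/-- The scalar bookkeeping of one block: with `u = n/L²`, `L⁴·½(u + u² + K)² ≤ ½(n − n²)² + (16a³ + 2aL²K + (4a² + L²K)²)` for
`0 ≤ n ≤ 2a`, `K ≥ 0`, `L ≥ 1`. [folklore] -/
theorem block_bookkeeping {L n u a K : ℝ} (hL : 1 ≤ L) (hn0 : 0 ≤ n) (hn : n ≤ 2 * a) (hK : 0 ≤ K) (hu : u = n / L ^ 2) :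
    L ^ 4 * (1 / 2 * (u + u ^ 2 + K) ^ 2) ≤ 1 / 2 * (n - n ^ 2) ^ 2 + (16 * a ^ 3 + 2 * a * L ^ 2 * K + (4 * a ^ 2 + L ^ 2 * K) ^ 2) := by
  subst hu
  have hL0 : 0 < L := by linarith
  have hL2 : 1 ≤ L ^ 2 := one_le_pow₀ hL
  have hkey : L ^ 4 * (1 / 2 * (n / L ^ 2 + (n / L ^ 2) ^ 2 + K) ^ 2) = 1 / 2 * (n + (n ^ 2 / L ^ 2 + L ^ 2 * K)) ^ 2 := by
    field_simp
    ring
  rw [hkey]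
  set α := n ^ 2 / L ^ 2 + L ^ 2 * K with hα
  have h1 : n ^ 2 / L ^ 2 ≤ n ^ 2 := div_le_self (sq_nonneg n) hL2
  have hα0 : 0 ≤ α := by rw [hα]; positivity
  have hn2 : n ^ 2 ≤ 4 * a ^ 2 := by nlinarith
  have hα1 : α ≤ 4 * a ^ 2 + L ^ 2 * K := by rw [hα]; linarith
  have h3 : n * α ≤ 2 * a * (4 * a ^ 2 + L ^ 2 * K) := mul_le_mul hn hα1 hα0 (by linarith)
  have h4 : α ^ 2 ≤ (4 * a ^ 2 + L ^ 2 * K) ^ 2 := pow_le_pow_left₀ hα0 hα1 2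
  have h5 : n ^ 3 ≤ 8 * a ^ 3 := by
    have := pow_le_pow_left₀ hn0 hn 3; nlinarith
  have h6 : 1 / 2 * (n + α) ^ 2 - 1 / 2 * (n - n ^ 2) ^ 2 ≤ n * α + 1 / 2 * α ^ 2 + n ^ 3 := by
    nlinarith [sq_nonneg n, sq_nonneg (n ^ 2), mul_nonneg hn0 (sq_nonneg n)]
  nlinarith

/-- **`L⁴·A(W) ≤ L^d·(A(V) + #plaq·Err)` FROM THE BLOCK STRUCTURE**: any fine `SU(2)` field whose plaquettes at the sites of `B(y)` are within
`K` of `exp(F_{κλ}(y)/L²)` carries `L^{d−4}` of the action of `V` up to `Err = 16a³ + 2aL²K + (4a² + L²K)²` per coarse plaquette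
(`|V(∂p) − 1| ≤ a ≤ 1/6`). [cite: King1986, (A.5) p.676] -/
theorem wilsonAction4_le_of_structure (hj : j + 1 ≤ P.m + P.K) (V : GaugeField P (j+1) (Matrix.specialUnitaryGroup (Fin 2) ℂ))
    (W : GaugeField P j (Matrix.specialUnitaryGroup (Fin 2) ℂ)) {a K : ℝ} (ha6 : a ≤ 1 / 6) (hK : 0 ≤ K)
    (hV : ∀ (y : Site P (j+1)) (κ μ : Fin P.d),
      ‖((plaqElt V y κ μ : Matrix.specialUnitaryGroup (Fin 2) ℂ) : Matrix (Fin 2) (Fin 2) ℂ) - 1‖ ≤ a)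
    (hS : ∀ q : Plaq P j, ‖((GaugeField.plaqHol W q : Matrix.specialUnitaryGroup (Fin 2) ℂ) : Matrix (Fin 2) (Fin 2) ℂ) -
        exp ((1 / (P.L : ℝ) ^ 2) • curv V (blockOf q.src) q.μ q.ν)‖ ≤ K) :
    (P.L : ℝ) ^ 4 * wilsonAction4 W ≤
      (P.L : ℝ) ^ P.d * (wilsonAction4 V + (Fintype.card (Plaq P (j+1)) : ℝ) * (16 * a ^ 3 + 2 * a * (P.L : ℝ) ^ 2 * K + (4 * a ^ 2 + (P.L : ℝ) ^ 2 * K) ^ 2)) := by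
  have hL1 : (1 : ℝ) ≤ P.L := by exact_mod_cast P.L_pos
  set Err := 16 * a ^ 3 + 2 * a * (P.L : ℝ) ^ 2 * K + (4 * a ^ 2 + (P.L : ℝ) ^ 2 * K) ^ 2 with hErr
  have hblock : ∀ p : Plaq P (j+1),
      (P.L : ℝ) ^ 4 * ∑ r : Fin P.d → Fin P.L, (1 - reTr (GaugeField.plaqHol W ⟨Site.blockSite p.src r, p.μ, p.ν, p.hμν⟩)) ≤
        (P.L : ℝ) ^ P.d * ((1 - reTr (GaugeField.plaqHol V p)) + Err) := by
    intro p
    set n : ℝ := ‖curv V p.src p.μ p.ν‖ with hn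
    have hn2 : n ≤ 2 * a := (norm_curv_le V _ _ _).trans (by linarith [hV p.src p.μ p.ν])
    have hn0 : 0 ≤ n := norm_nonneg _
    have hn1 : n ≤ 1 := by linarith
    have hu : ‖(1 / (P.L : ℝ) ^ 2) • curv V p.src p.μ p.ν‖ = n / (P.L : ℝ) ^ 2 := by
      rw [norm_smul, Real.norm_of_nonneg (by positivity), hn]; ring
    have hu1 : ‖(1 / (P.L : ℝ) ^ 2) • curv V p.src p.μ p.ν‖ ≤ 1 := by
      rw [hu]; exact div_le_one_of_le₀ (hn1.trans (one_le_pow₀ hL1)) (by positivity)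
    have hfine : ∀ r : Fin P.d → Fin P.L, 1 - reTr (GaugeField.plaqHol W ⟨Site.blockSite p.src r, p.μ, p.ν, p.hμν⟩) ≤
        1 / 2 * (n / (P.L : ℝ) ^ 2 + (n / (P.L : ℝ) ^ 2) ^ 2 + K) ^ 2 := by
      intro r
      have hstr := hS ⟨Site.blockSite p.src r, p.μ, p.ν, p.hμν⟩
      have hbl : blockOf (Site.blockSite p.src r) = p.src := Site.blockOf_blockSite hj p.src r
      simp only [hbl] at hstr
      have h := one_sub_reTr_le_of_near_exp hstr hu1
      rwa [hu] at h
    have hcoarse : 1 / 2 * (n - n ^ 2) ^ 2 ≤ 1 - reTr (GaugeField.plaqHol V p) := by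
      have hsmall : ‖((plaqElt V p.src p.μ p.ν : Matrix.specialUnitaryGroup (Fin 2) ℂ) : Matrix (Fin 2) (Fin 2) ℂ) - 1‖ ≤ 1 / 3 :=
        (hV _ _ _).trans (by linarith)
      have hP : GaugeField.plaqHol V p = plaqElt V p.src p.μ p.ν := (plaqElt_eq_plaqHol V p.src p.hμν).symm
      have hcurv : curv V p.src p.μ p.ν = mlog ((plaqElt V p.src p.μ p.ν : Matrix.specialUnitaryGroup (Fin 2) ℂ) : Matrix (Fin 2) (Fin 2) ℂ) :=
        curv_of_small hsmall
      have h := half_sq_le_one_sub_reTr hsmall (by rw [← hcurv]; exact hn1)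
      rwa [← hcurv, ← hn, ← hP] at h
    have hcard : (Fintype.card (Fin P.d → Fin P.L) : ℝ) = (P.L : ℝ) ^ P.d := by
      rw [Fintype.card_fun, Fintype.card_fin, Fintype.card_fin]; push_cast; ring
    have hsum : ∑ r : Fin P.d → Fin P.L, (1 - reTr (GaugeField.plaqHol W ⟨Site.blockSite p.src r, p.μ, p.ν, p.hμν⟩)) ≤
        (P.L : ℝ) ^ P.d * (1 / 2 * (n / (P.L : ℝ) ^ 2 + (n / (P.L : ℝ) ^ 2) ^ 2 + K) ^ 2) := by
      calc _ ≤ ∑ _r : Fin P.d → Fin P.L, 1 / 2 * (n / (P.L : ℝ) ^ 2 + (n / (P.L : ℝ) ^ 2) ^ 2 + K) ^ 2 :=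
            Finset.sum_le_sum fun r _ => hfine r
        _ = _ := by rw [Finset.sum_const, Finset.card_univ, nsmul_eq_mul, hcard]
    have harith := block_bookkeeping (K := K) hL1 hn0 hn2 hK (rfl : n / (P.L : ℝ) ^ 2 = n / (P.L : ℝ) ^ 2)
    have hLd : (0 : ℝ) ≤ (P.L : ℝ) ^ P.d := by positivity
    calc _ ≤ (P.L : ℝ) ^ 4 * ((P.L : ℝ) ^ P.d * (1 / 2 * (n / (P.L : ℝ) ^ 2 + (n / (P.L : ℝ) ^ 2) ^ 2 + K) ^ 2)) := by gcongr
      _ = (P.L : ℝ) ^ P.d * ((P.L : ℝ) ^ 4 * (1 / 2 * (n / (P.L : ℝ) ^ 2 + (n / (P.L : ℝ) ^ 2) ^ 2 + K) ^ 2)) := by ring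
      _ ≤ (P.L : ℝ) ^ P.d * (1 / 2 * (n - n ^ 2) ^ 2 + Err) := by rw [hErr]; gcongr
      _ ≤ _ := by gcongr
  unfold wilsonAction4 wilsonAction
  simp only [one_mul]
  rw [← sum_coarse_block hj (fun q => 1 - reTr (GaugeField.plaqHol W q)), Finset.mul_sum]
  calc ∑ p : Plaq P (j+1), (P.L : ℝ) ^ 4 * ∑ r : Fin P.d → Fin P.L, (1 - reTr (GaugeField.plaqHol W ⟨Site.blockSite p.src r, p.μ, p.ν, p.hμν⟩))
      ≤ ∑ p : Plaq P (j+1), (P.L : ℝ) ^ P.d * ((1 - reTr (GaugeField.plaqHol V p)) + Err) := Finset.sum_le_sum fun p _ => hblock p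
    _ = (P.L : ℝ) ^ P.d * (∑ p : Plaq P (j+1), (1 - reTr (GaugeField.plaqHol V p)) + (Fintype.card (Plaq P (j+1)) : ℝ) * Err) := by
        rw [← Finset.mul_sum, Finset.sum_add_distrib, Finset.sum_const, Finset.card_univ, nsmul_eq_mul]

end Action

/-! ## §2 The coarse field read at level 1: ordered plaquettes and the covariant-constancy defect of its log-curvature -/

section Coarse

variable {P : Params} {j : ℕ}

/-- **ALL ORDERED PLAQUETTES ARE SMALL** if the positively oriented ones are: `|V(∂p_{κλ}) − 1| ≤ a` for `κ < λ` gives the same for all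
`(κ, λ)` (`1` on the diagonal, the inverse below it). [cite: Balaban1985Averaging, (9) p.19] -/
theorem norm_plaqElt_sub_one_le (V : GaugeField P (j+1) (Matrix.specialUnitaryGroup (Fin 2) ℂ)) {a : ℝ} (ha : 0 ≤ a)
    (hV : ∀ p : Plaq P (j+1), dist1 (GaugeField.plaqHol V p) ≤ a) (y : Site P (j+1)) (κ μ : Fin P.d) :
    ‖((plaqElt V y κ μ : Matrix.specialUnitaryGroup (Fin 2) ℂ) : Matrix (Fin 2) (Fin 2) ℂ) - 1‖ ≤ a := by
  rcases lt_trichotomy κ μ with h | h | h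
  · rw [plaqElt_eq_plaqHol V y h]; exact hV ⟨y, κ, μ, h⟩
  · subst h; rw [plaqElt_self]; simp [ha]
  · rw [plaqElt_swap, coe_inv_su2, ExpMeanLog.norm_star_sub_one, plaqElt_eq_plaqHol V y h]; exact hV ⟨y, μ, κ, h⟩

/-- **THE LOG-CURVATURE IS COVARIANTLY CONSTANT UP TO `(3/2)b`**: if every backward covariant derivative of every plaquette field of `V`
([Balaban1985RegularSpaces] (1.1)) is `≤ b` and the plaquettes are within `a ≤ 1/3` of `1`, then
`‖V(y,κ)·F_{ρλ}(y+e_κ)·V(y,κ)* − F_{ρλ}(y)‖ ≤ (3/2)b` (`F = log V(∂p)`; the logarithm is `3/2`-Lipschitz on `|X − 1| ≤ 1/3`).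
[cite: Balaban1985RegularSpaces, (1.1) p.76] -/
theorem norm_conj_curv_sub_curv_le (V : GaugeField P (j+1) (Matrix.specialUnitaryGroup (Fin 2) ℂ)) {a b : ℝ} (ha : 0 ≤ a) (ha3 : a ≤ 1 / 3)
    (hb : 0 ≤ b) (hV : ∀ p : Plaq P (j+1), dist1 (GaugeField.plaqHol V p) ≤ a)
    (hgrad : ∀ (x : Site P (j+1)) (ν κ κ' : Fin P.d), κ ≠ κ' →
      ‖covDerivT 1 (unitsField (toUField V)) ν (plaqFT (unitsField (toUField V)) κ κ') x‖ ≤ b)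
    (y : Site P (j+1)) (κ ρ μ : Fin P.d) :
    ‖((V ⟨y, κ⟩ : Matrix.specialUnitaryGroup (Fin 2) ℂ) : Matrix (Fin 2) (Fin 2) ℂ) * curv V (y.shift κ) ρ μ *
        star ((V ⟨y, κ⟩ : Matrix.specialUnitaryGroup (Fin 2) ℂ) : Matrix (Fin 2) (Fin 2) ℂ) - curv V y ρ μ‖ ≤ 3 / 2 * b := by
  -- the positively oriented case
  have key : ∀ {ρ μ : Fin P.d}, ρ < μ →
      ‖((V ⟨y, κ⟩ : Matrix.specialUnitaryGroup (Fin 2) ℂ) : Matrix (Fin 2) (Fin 2) ℂ) * curv V (y.shift κ) ρ μ *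
          star ((V ⟨y, κ⟩ : Matrix.specialUnitaryGroup (Fin 2) ℂ) : Matrix (Fin 2) (Fin 2) ℂ) - curv V y ρ μ‖ ≤ 3 / 2 * b := by
    intro ρ μ h
    set u : Matrix (Fin 2) (Fin 2) ℂ := ((V ⟨y, κ⟩ : Matrix.specialUnitaryGroup (Fin 2) ℂ) : Matrix (Fin 2) (Fin 2) ℂ) with hu
    set P₀ : Matrix (Fin 2) (Fin 2) ℂ := ((plaqElt V y ρ μ : Matrix.specialUnitaryGroup (Fin 2) ℂ) : Matrix (Fin 2) (Fin 2) ℂ) with hP₀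
    set P₁ : Matrix (Fin 2) (Fin 2) ℂ := ((plaqElt V (y.shift κ) ρ μ : Matrix.specialUnitaryGroup (Fin 2) ℂ) : Matrix (Fin 2) (Fin 2) ℂ) with hP₁
    have huu : u * star u = 1 := Matrix.mem_unitaryGroup_iff.1 (Matrix.mem_specialUnitaryGroup_iff.1 (V ⟨y, κ⟩).2).1
    have huu' : star u * u = 1 := Matrix.mem_unitaryGroup_iff'.1 (Matrix.mem_specialUnitaryGroup_iff.1 (V ⟨y, κ⟩).2).1
    have h0 : ‖P₀ - 1‖ ≤ a := norm_plaqElt_sub_one_le V ha hV y ρ μ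
    have h1 : ‖P₁ - 1‖ ≤ a := norm_plaqElt_sub_one_le V ha hV (y.shift κ) ρ μ
    -- (1.1): `‖u* P₀ u − P₁‖ ≤ b`, i.e. `‖u P₁ u* − P₀‖ ≤ b`
    have hg := hgrad (y.shift κ) κ ρ μ (ne_of_lt h)
    rw [covDerivT_plaqFT_shift_eq V κ h y, Submonoid.coe_mul, Submonoid.coe_mul, coe_inv_su2, ← plaqElt_eq_plaqHol, ← plaqElt_eq_plaqHol] at hg
    change ‖star u * P₀ * u - P₁‖ ≤ b at hg
    have hconj : ‖u * P₁ * star u - P₀‖ ≤ b := by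
      have hid : u * P₁ * star u - P₀ = -(u * (star u * P₀ * u - P₁) * star u) := by
        have : u * (star u * P₀ * u) * star u = (u * star u) * P₀ * (u * star u) := by noncomm_ring
        rw [mul_sub, sub_mul, this, huu, one_mul, mul_one]; abel
      rw [hid, norm_neg, norm_conj_eq (V ⟨y, κ⟩)]; exact hg
    -- logarithms
    have h1' : ‖u * P₁ * star u - 1‖ ≤ 1 / 3 := by
      rw [show u * P₁ * star u - 1 = u * (P₁ - 1) * star u by rw [mul_sub, sub_mul, mul_one, huu], norm_conj_eq (V ⟨y, κ⟩)]
      exact h1.trans ha3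
    have hlip := FederbushMean.norm_mlog_sub_mlog_le (ρ := 1 / 3) (by norm_num) h1' (h0.trans ha3)
    rw [curv_of_small (h1.trans ha3), curv_of_small (h0.trans ha3), ← ExpMeanLog.mlog_conj huu huu' P₁]
    calc _ ≤ (1 + 1 / 3 / (1 - 1 / 3)) * ‖u * P₁ * star u - P₀‖ := hlip
      _ ≤ (1 + 1 / 3 / (1 - 1 / 3)) * b := by gcongr
      _ = 3 / 2 * b := by ring
  rcases lt_trichotomy ρ μ with h | h | h
  · exact key h
  · subst h; rw [curv_self, curv_self, mul_zero, zero_mul, sub_zero, norm_zero]; positivity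
  · have hk := key h
    rw [curv_swap V (y.shift κ) μ ρ, curv_swap V y μ ρ, mul_neg, neg_mul, ← neg_add', ← sub_eq_add_neg, norm_neg]
    exact hk

end Coarse

end Summit.QuantumFields.YangMills.Theorems.SmoothLift

end
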